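import Summits.QuantumFields.YangMills.Theorems.FluctuationComparisonRegPrIntLS2BetaRelativeLadderVarStep
import HarnessLib

/-!
# S2β · (LIFT-V) §2a — THE TWO-SQUARE (TRANSLATE) `V`-STEP: for two parallel unit squares `S` at `z` and `S′ = S + e_τ`, the covariant difference of the FAR-rung chords
# is bounded by the covariant difference of the NEAR-rung chords plus the two rail-pair differences plus the two relative plaquettes — EXACT group algebra (three-factor
# telescoping), any torus, any `GaugeGroup`, ANY transport `Y` for the near pair (the far pair is then transported by `X = W_top⁻¹·Y·W_top′`)

Cell `ym3-torus` (rung R3 = continuum `SU(2)` Yang–Mills on the three-torus — NOT d = 4, NOT infinite volume, NOT a mass gap, NOT Clay).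
Width seat «width 21» `ym3-torus-px21` (gen 24); `--kind proof --supports stmt-QuantumFields-20520 --as helper`, count-neutral, DEFINITION-FREE
(0 `def`, 0 `instance`, 0 `notation`, 0 `sorry`, default heartbeats); generic `P : Params`, ANY `GaugeGroup G`.

WHY (LIFT-LADDER ✓p830137; px16 g22 17:10:38Z∕17:25:00Z «two-profile (M, V) recursion; closure for `V_t` on rung bonds = the delicate entry: adjacent ladders are TRANSLATES»;
px20 g23 17:26:50Z allocation; px21 g24 INTENT (LIFT-V) 17:47:52Z, §1 ✓p830549).  The `V`-row at a RUNG bond needs the transverse difference (direction `τ`) of the far-rung chords of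
two parallel ladders; ladder by ladder, the far rung is `W_top⁻¹·(rail pair)·(relative plaquette)·(near rung)·W_top` EXACTLY (§1 ✓`rungPair_eq` solved for `r_far`), so the
difference of two far rungs telescopes into the difference of the near rungs plus the SUM of the two rail-pair terms plus the two relative plaquettes — «the crude factor 2 on second
differences» of UV3-NODE §97∕the (W2) census IS this telescoping; no cube ∕ Bianchi identity is needed for the `V`-row's `T₂₂ = 5∕L²` count.
* §1 ★ `dist1_triple_telescope` — `dist1 ((a′b′c′)·(abc)⁻¹) ≤ dist1 (a′a⁻¹) + dist1 (b′b⁻¹) + dist1 (c′c⁻¹)` (the non-abelian product rule: `(a′b′c′)(abc)⁻¹ = (a′a⁻¹)·Ad_a(b′b⁻¹)·Ad_{ab}(c′c⁻¹)`);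
  ★ `dist1_conj_mul_inv_le` — `dist1 (Y·x′·Y⁻¹·x⁻¹) ≤ dist1 x′ + dist1 x` (the crude bound for a transported difference of two SMALL quantities).
* §2 `farRung_eq` — the far-rung chord of ONE square: `U_far⁻¹W_far = W_top⁻¹·[(W_topU_top⁻¹)·T⁻¹(U_botW_bot⁻¹)T]·[U_near⁻¹(□_U⁻¹□_W)U_near]·(U_near⁻¹W_near)·W_top` (free group);
  ★★★ `dist1_farRungPair_le` — THE TWO-SQUARE STEP: with `X := W_top⁻¹·Y·W_top′`,
      `dist1 (X·r′_far·X⁻¹·r_far⁻¹) ≤ dist1 (Y·r′_near·Y⁻¹·r_near⁻¹) + dist1 (rail pair S) + dist1 (rail pair S′) + dist1 (□_U⁻¹□_W) + dist1 (□′_U⁻¹□′_W)`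
  — in the two-profile recursion: `V(far rungs) ≤ V(near rungs) + 2·(V of TREE rail pairs ≤ L⁻²V′) + 2ρ`, iterated `≤ (L−1)∕2` times down an axis run to a COMB pair;
  ★★ `dist1_nearRungPair_le` — the same two squares read from the far side (negative comb runs).
The `d = 3` pair-class chase over the lexicographic tree comb (which pairs are comb pairs, which reduce by ONE square via §1 ✓`dist1_railPair_rel_le`∕`dist1_rungPair_rel_le`, which
need this two-square descent; `T₂₂ = 5∕L²`, sources `≤ 5ρ`) is the docstring table of INTENT 17:47:52Z and the next file.

HONEST SCOPE.  Group algebra on two lattice squares; nothing of Bałaban's analysis is asserted or proved; the comb chase, the aggregation over read sets, (TOP-LAD)∕(LIFT-LAD)∕(SCT-c),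
(ST)'s discharge, LOC, D-GUARD, GAP♯∘ (`stub_uniformFibreGapOrbit`, registry untouched, 0∕5), S2β, crux 20520 and `YM3TorusSU2` are NOT proved; no registered stub is closed;
rung R3 = SU(2) YM₃ on T³ — NOT d = 4, NOT infinite volume, NOT a mass gap, NOT Clay; the Yang–Mills mass gap is NOT proved.
References: T. Bałaban, CMP **122** (1989) 355–392 [Balaban1989LargeFieldII] (p.382); CMP **98** (1985) 17–51 [Balaban1985Averaging] ((9)–(10) p.19, (19) p.21);
CMP **99** (1985) 75–102 [Balaban1985RegularSpaces] ((1.29) p.81).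
-/

set_option autoImplicit false

namespace Summit.QuantumFields.YangMills.Theorems.FluctuationComparisonRegPrIntLS2BetaRelativeLadderVarTwoSquare

open Literature.MathematicalPhysics.QuantumFieldTheory.Balaban1983to89
open Literature.MathematicalPhysics.QuantumFieldTheory.Balaban1983to89.T4Continuum

variable {P : Params} {j : ℕ} {G : Type*} [GaugeGroup G]

/-! ## §1 Two small group lemmas -/

/-- ★ **THE NON-ABELIAN PRODUCT RULE**: `dist1 ((a′b′c′)·(abc)⁻¹) ≤ dist1 (a′a⁻¹) + dist1 (b′b⁻¹) + dist1 (c′c⁻¹)`, from the exact telescoping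
`(a′b′c′)(abc)⁻¹ = (a′a⁻¹)·a(b′b⁻¹)a⁻¹·(ab)(c′c⁻¹)(ab)⁻¹` and conjugation invariance. [folklore] -/
theorem dist1_triple_telescope (a b c a' b' c' : G) :
    dist1 (a' * b' * c' * (a * b * c)⁻¹) ≤ dist1 (a' * a⁻¹) + dist1 (b' * b⁻¹) + dist1 (c' * c⁻¹) := by
  have key : a' * b' * c' * (a * b * c)⁻¹ = (a' * a⁻¹) * ((a * (b' * b⁻¹) * a⁻¹) * ((a * b) * (c' * c⁻¹) * (a * b)⁻¹)) := by group
  rw [key]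
  have h1 := GaugeGroup.dist1_mul_le (a' * a⁻¹) ((a * (b' * b⁻¹) * a⁻¹) * ((a * b) * (c' * c⁻¹) * (a * b)⁻¹))
  have h2 := GaugeGroup.dist1_mul_le (a * (b' * b⁻¹) * a⁻¹) ((a * b) * (c' * c⁻¹) * (a * b)⁻¹)
  rw [GaugeGroup.dist1_conj, GaugeGroup.dist1_conj] at h2
  linarith

/-- ★ **A TRANSPORTED DIFFERENCE OF TWO SMALL QUANTITIES IS AT MOST THEIR SUM**: `dist1 (Y·x′·Y⁻¹·x⁻¹) ≤ dist1 x′ + dist1 x`. [folklore] -/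
theorem dist1_conj_mul_inv_le (Y x x' : G) : dist1 (Y * x' * Y⁻¹ * x⁻¹) ≤ dist1 x' + dist1 x := by
  have h := GaugeGroup.dist1_mul_le (Y * x' * Y⁻¹) x⁻¹
  rw [GaugeGroup.dist1_conj, GaugeGroup.dist1_inv] at h
  exact h

/-! ## §2 The two-square step -/

/-- **THE FAR-RUNG CHORD OF ONE SQUARE, SOLVED** (free-group identity; §1 ✓`rungPair_eq` of ✓p830549 rearranged): with `T = □_U·U_near`,
`U_far⁻¹W_far = W_top⁻¹·[(W_topU_top⁻¹)·T⁻¹(U_botW_bot⁻¹)T]·[U_near⁻¹(□_U⁻¹□_W)U_near]·(U_near⁻¹W_near)·W_top`. [cite: Balaban1989LargeFieldII, p.382 (bookkeeping)] -/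
theorem farRung_eq (W U : GaugeField P j G) (z : Site P j) (κ e : Fin P.d) :
    (U ⟨z.shift κ, e⟩)⁻¹ * W ⟨z.shift κ, e⟩ =
      (W ⟨z.shift e, κ⟩)⁻¹ *
        (((W ⟨z.shift e, κ⟩ * (U ⟨z.shift e, κ⟩)⁻¹) *
            ((U ⟨z, κ⟩ * U ⟨z.shift κ, e⟩ * (U ⟨z.shift e, κ⟩)⁻¹ * (U ⟨z, e⟩)⁻¹ * U ⟨z, e⟩)⁻¹ * (U ⟨z, κ⟩ * (W ⟨z, κ⟩)⁻¹) *
              (U ⟨z, κ⟩ * U ⟨z.shift κ, e⟩ * (U ⟨z.shift e, κ⟩)⁻¹ * (U ⟨z, e⟩)⁻¹ * U ⟨z, e⟩))) *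
          ((U ⟨z, e⟩)⁻¹ *
              ((U ⟨z, κ⟩ * U ⟨z.shift κ, e⟩ * (U ⟨z.shift e, κ⟩)⁻¹ * (U ⟨z, e⟩)⁻¹)⁻¹ *
                (W ⟨z, κ⟩ * W ⟨z.shift κ, e⟩ * (W ⟨z.shift e, κ⟩)⁻¹ * (W ⟨z, e⟩)⁻¹)) * U ⟨z, e⟩) *
          ((U ⟨z, e⟩)⁻¹ * W ⟨z, e⟩)) * W ⟨z.shift e, κ⟩ := by
  set Ub := U ⟨z, κ⟩; set Uf := U ⟨z.shift κ, e⟩; set Ut := U ⟨z.shift e, κ⟩; set Un := U ⟨z, e⟩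
  set Wb := W ⟨z, κ⟩; set Wf := W ⟨z.shift κ, e⟩; set Wt := W ⟨z.shift e, κ⟩; set Wn := W ⟨z, e⟩
  group

/-- ★★★ **THE TWO-SQUARE (TRANSLATE) `V`-STEP**: two parallel unit squares, `S` at `z` and `S′` at `z + e_τ` (rail direction `κ`, rung direction `e`), any `Y : G` transporting the
NEAR pair, and `X := W_top⁻¹·Y·W_top′` the induced transport of the FAR pair.  Then
    `dist1 (X·r′_far·X⁻¹·r_far⁻¹) ≤ dist1 (Y·r′_near·Y⁻¹·r_near⁻¹) + dist1 (rail pair S) + dist1 (rail pair S′) + dist1 (□_U⁻¹□_W) + dist1 (□′_U⁻¹□′_W)`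
(rungs `r = U⁻¹W`, rail pairs in ✓p830038's form `(W_topU_top⁻¹)·T⁻¹(U_botW_bot⁻¹)T`).  Exact group algebra: `farRung_eq` twice + `dist1_triple_telescope` + `dist1_conj_mul_inv_le`.
[cite: Balaban1989LargeFieldII, p.382; Balaban1985Averaging, (9)-(10) p.19 (bookkeeping); Balaban1985RegularSpaces, (1.29) p.81] -/
theorem dist1_farRungPair_le (W U : GaugeField P j G) (z : Site P j) (κ e τ : Fin P.d) (Y : G) :
    dist1 (((W ⟨z.shift e, κ⟩)⁻¹ * Y * W ⟨(z.shift τ).shift e, κ⟩) *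
          ((U ⟨(z.shift τ).shift κ, e⟩)⁻¹ * W ⟨(z.shift τ).shift κ, e⟩) *
          ((W ⟨z.shift e, κ⟩)⁻¹ * Y * W ⟨(z.shift τ).shift e, κ⟩)⁻¹ *
          ((U ⟨z.shift κ, e⟩)⁻¹ * W ⟨z.shift κ, e⟩)⁻¹) ≤
      dist1 (Y * ((U ⟨z.shift τ, e⟩)⁻¹ * W ⟨z.shift τ, e⟩) * Y⁻¹ * ((U ⟨z, e⟩)⁻¹ * W ⟨z, e⟩)⁻¹) +
        dist1 ((W ⟨z.shift e, κ⟩ * (U ⟨z.shift e, κ⟩)⁻¹) *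
          ((U ⟨z, κ⟩ * U ⟨z.shift κ, e⟩ * (U ⟨z.shift e, κ⟩)⁻¹ * (U ⟨z, e⟩)⁻¹ * U ⟨z, e⟩)⁻¹ * (U ⟨z, κ⟩ * (W ⟨z, κ⟩)⁻¹) *
            (U ⟨z, κ⟩ * U ⟨z.shift κ, e⟩ * (U ⟨z.shift e, κ⟩)⁻¹ * (U ⟨z, e⟩)⁻¹ * U ⟨z, e⟩))) +
        dist1 ((W ⟨(z.shift τ).shift e, κ⟩ * (U ⟨(z.shift τ).shift e, κ⟩)⁻¹) *
          ((U ⟨z.shift τ, κ⟩ * U ⟨(z.shift τ).shift κ, e⟩ * (U ⟨(z.shift τ).shift e, κ⟩)⁻¹ * (U ⟨z.shift τ, e⟩)⁻¹ * U ⟨z.shift τ, e⟩)⁻¹ *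
              (U ⟨z.shift τ, κ⟩ * (W ⟨z.shift τ, κ⟩)⁻¹) *
            (U ⟨z.shift τ, κ⟩ * U ⟨(z.shift τ).shift κ, e⟩ * (U ⟨(z.shift τ).shift e, κ⟩)⁻¹ * (U ⟨z.shift τ, e⟩)⁻¹ * U ⟨z.shift τ, e⟩))) +
        dist1 ((U ⟨z, κ⟩ * U ⟨z.shift κ, e⟩ * (U ⟨z.shift e, κ⟩)⁻¹ * (U ⟨z, e⟩)⁻¹)⁻¹ *
          (W ⟨z, κ⟩ * W ⟨z.shift κ, e⟩ * (W ⟨z.shift e, κ⟩)⁻¹ * (W ⟨z, e⟩)⁻¹)) +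
        dist1 ((U ⟨z.shift τ, κ⟩ * U ⟨(z.shift τ).shift κ, e⟩ * (U ⟨(z.shift τ).shift e, κ⟩)⁻¹ * (U ⟨z.shift τ, e⟩)⁻¹)⁻¹ *
          (W ⟨z.shift τ, κ⟩ * W ⟨(z.shift τ).shift κ, e⟩ * (W ⟨(z.shift τ).shift e, κ⟩)⁻¹ * (W ⟨z.shift τ, e⟩)⁻¹)) := by
  -- square S
  set Ub := U ⟨z, κ⟩; set Uf := U ⟨z.shift κ, e⟩; set Ut := U ⟨z.shift e, κ⟩; set Un := U ⟨z, e⟩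
  set Wb := W ⟨z, κ⟩; set Wf := W ⟨z.shift κ, e⟩; set Wt := W ⟨z.shift e, κ⟩; set Wn := W ⟨z, e⟩
  -- square S′
  set Ub' := U ⟨z.shift τ, κ⟩; set Uf' := U ⟨(z.shift τ).shift κ, e⟩; set Ut' := U ⟨(z.shift τ).shift e, κ⟩; set Un' := U ⟨z.shift τ, e⟩
  set Wb' := W ⟨z.shift τ, κ⟩; set Wf' := W ⟨(z.shift τ).shift κ, e⟩; set Wt' := W ⟨(z.shift τ).shift e, κ⟩; set Wn' := W ⟨z.shift τ, e⟩
  -- the six factors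
  set A := (Wt * Ut⁻¹) * ((Ub * Uf * Ut⁻¹ * Un⁻¹ * Un)⁻¹ * (Ub * Wb⁻¹) * (Ub * Uf * Ut⁻¹ * Un⁻¹ * Un))
  set B := Un⁻¹ * ((Ub * Uf * Ut⁻¹ * Un⁻¹)⁻¹ * (Wb * Wf * Wt⁻¹ * Wn⁻¹)) * Un
  set C := Un⁻¹ * Wn
  set A' := (Wt' * Ut'⁻¹) * ((Ub' * Uf' * Ut'⁻¹ * Un'⁻¹ * Un')⁻¹ * (Ub' * Wb'⁻¹) * (Ub' * Uf' * Ut'⁻¹ * Un'⁻¹ * Un'))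
  set B' := Un'⁻¹ * ((Ub' * Uf' * Ut'⁻¹ * Un'⁻¹)⁻¹ * (Wb' * Wf' * Wt'⁻¹ * Wn'⁻¹)) * Un'
  set C' := Un'⁻¹ * Wn'
  -- the two far rungs, solved
  have hf : Uf⁻¹ * Wf = Wt⁻¹ * (A * B * C) * Wt := by simp only [A, B, C]; group
  have hf' : Uf'⁻¹ * Wf' = Wt'⁻¹ * (A' * B' * C') * Wt' := by simp only [A', B', C']; group
  -- conjugate the whole difference back by `W_top`
  have key : (Wt⁻¹ * Y * Wt') * (Uf'⁻¹ * Wf') * (Wt⁻¹ * Y * Wt')⁻¹ * (Uf⁻¹ * Wf)⁻¹ =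
      Wt⁻¹ * ((Y * A' * Y⁻¹) * (Y * B' * Y⁻¹) * (Y * C' * Y⁻¹) * (A * B * C)⁻¹) * Wt⁻¹⁻¹ := by
    rw [hf, hf']; group
  rw [key, GaugeGroup.dist1_conj]
  have h1 := dist1_triple_telescope A B C (Y * A' * Y⁻¹) (Y * B' * Y⁻¹) (Y * C' * Y⁻¹)
  have hA := dist1_conj_mul_inv_le Y A A'
  have hB := dist1_conj_mul_inv_le Y B B'
  have hBq : dist1 B = dist1 ((Ub * Uf * Ut⁻¹ * Un⁻¹)⁻¹ * (Wb * Wf * Wt⁻¹ * Wn⁻¹)) := by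
    have h : B = Un⁻¹ * ((Ub * Uf * Ut⁻¹ * Un⁻¹)⁻¹ * (Wb * Wf * Wt⁻¹ * Wn⁻¹)) * Un⁻¹⁻¹ := by simp only [B, inv_inv]
    rw [h, GaugeGroup.dist1_conj]
  have hBq' : dist1 B' = dist1 ((Ub' * Uf' * Ut'⁻¹ * Un'⁻¹)⁻¹ * (Wb' * Wf' * Wt'⁻¹ * Wn'⁻¹)) := by
    have h : B' = Un'⁻¹ * ((Ub' * Uf' * Ut'⁻¹ * Un'⁻¹)⁻¹ * (Wb' * Wf' * Wt'⁻¹ * Wn'⁻¹)) * Un'⁻¹⁻¹ := by simp only [B', inv_inv]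
    rw [h, GaugeGroup.dist1_conj]
  have hC : dist1 (Y * C' * Y⁻¹ * C⁻¹) = dist1 (Y * (Un'⁻¹ * Wn') * Y⁻¹ * (Un⁻¹ * Wn)⁻¹) := by simp only [C, C']
  linarith [h1, hA, hB, hBq.le, hBq.ge, hBq'.le, hBq'.ge, hC.le, hC.ge]


/-- ★★ **THE TWO-SQUARE STEP, BACKWARD** (the same pair of squares read from the far side, for comb runs walked in the negative direction — centred blocks have both signs): with
`X := W_top⁻¹·Y·W_top′` as above, `dist1 (Y·r′_near·Y⁻¹·r_near⁻¹) ≤ dist1 (X·r′_far·X⁻¹·r_far⁻¹) + dist1 (rail pair S) + dist1 (rail pair S′) + dist1 (□_U⁻¹□_W) + dist1 (□′_U⁻¹□′_W)`.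
[cite: Balaban1989LargeFieldII, p.382; Balaban1985Averaging, (9)-(10) p.19 (bookkeeping)] -/
theorem dist1_nearRungPair_le (W U : GaugeField P j G) (z : Site P j) (κ e τ : Fin P.d) (Y : G) :
    dist1 (Y * ((U ⟨z.shift τ, e⟩)⁻¹ * W ⟨z.shift τ, e⟩) * Y⁻¹ * ((U ⟨z, e⟩)⁻¹ * W ⟨z, e⟩)⁻¹) ≤
      dist1 (((W ⟨z.shift e, κ⟩)⁻¹ * Y * W ⟨(z.shift τ).shift e, κ⟩) *
          ((U ⟨(z.shift τ).shift κ, e⟩)⁻¹ * W ⟨(z.shift τ).shift κ, e⟩) *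
          ((W ⟨z.shift e, κ⟩)⁻¹ * Y * W ⟨(z.shift τ).shift e, κ⟩)⁻¹ *
          ((U ⟨z.shift κ, e⟩)⁻¹ * W ⟨z.shift κ, e⟩)⁻¹) +
        dist1 ((W ⟨z.shift e, κ⟩ * (U ⟨z.shift e, κ⟩)⁻¹) *
          ((U ⟨z, κ⟩ * U ⟨z.shift κ, e⟩ * (U ⟨z.shift e, κ⟩)⁻¹ * (U ⟨z, e⟩)⁻¹ * U ⟨z, e⟩)⁻¹ * (U ⟨z, κ⟩ * (W ⟨z, κ⟩)⁻¹) *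
            (U ⟨z, κ⟩ * U ⟨z.shift κ, e⟩ * (U ⟨z.shift e, κ⟩)⁻¹ * (U ⟨z, e⟩)⁻¹ * U ⟨z, e⟩))) +
        dist1 ((W ⟨(z.shift τ).shift e, κ⟩ * (U ⟨(z.shift τ).shift e, κ⟩)⁻¹) *
          ((U ⟨z.shift τ, κ⟩ * U ⟨(z.shift τ).shift κ, e⟩ * (U ⟨(z.shift τ).shift e, κ⟩)⁻¹ * (U ⟨z.shift τ, e⟩)⁻¹ * U ⟨z.shift τ, e⟩)⁻¹ *
              (U ⟨z.shift τ, κ⟩ * (W ⟨z.shift τ, κ⟩)⁻¹) *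
            (U ⟨z.shift τ, κ⟩ * U ⟨(z.shift τ).shift κ, e⟩ * (U ⟨(z.shift τ).shift e, κ⟩)⁻¹ * (U ⟨z.shift τ, e⟩)⁻¹ * U ⟨z.shift τ, e⟩))) +
        dist1 ((U ⟨z, κ⟩ * U ⟨z.shift κ, e⟩ * (U ⟨z.shift e, κ⟩)⁻¹ * (U ⟨z, e⟩)⁻¹)⁻¹ *
          (W ⟨z, κ⟩ * W ⟨z.shift κ, e⟩ * (W ⟨z.shift e, κ⟩)⁻¹ * (W ⟨z, e⟩)⁻¹)) +
        dist1 ((U ⟨z.shift τ, κ⟩ * U ⟨(z.shift τ).shift κ, e⟩ * (U ⟨(z.shift τ).shift e, κ⟩)⁻¹ * (U ⟨z.shift τ, e⟩)⁻¹)⁻¹ *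
          (W ⟨z.shift τ, κ⟩ * W ⟨(z.shift τ).shift κ, e⟩ * (W ⟨(z.shift τ).shift e, κ⟩)⁻¹ * (W ⟨z.shift τ, e⟩)⁻¹)) := by
  -- square S
  set Ub := U ⟨z, κ⟩; set Uf := U ⟨z.shift κ, e⟩; set Ut := U ⟨z.shift e, κ⟩; set Un := U ⟨z, e⟩
  set Wb := W ⟨z, κ⟩; set Wf := W ⟨z.shift κ, e⟩; set Wt := W ⟨z.shift e, κ⟩; set Wn := W ⟨z, e⟩
  -- square S′
  set Ub' := U ⟨z.shift τ, κ⟩; set Uf' := U ⟨(z.shift τ).shift κ, e⟩; set Ut' := U ⟨(z.shift τ).shift e, κ⟩; set Un' := U ⟨z.shift τ, e⟩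
  set Wb' := W ⟨z.shift τ, κ⟩; set Wf' := W ⟨(z.shift τ).shift κ, e⟩; set Wt' := W ⟨(z.shift τ).shift e, κ⟩; set Wn' := W ⟨z.shift τ, e⟩
  set A := (Wt * Ut⁻¹) * ((Ub * Uf * Ut⁻¹ * Un⁻¹ * Un)⁻¹ * (Ub * Wb⁻¹) * (Ub * Uf * Ut⁻¹ * Un⁻¹ * Un))
  set B := Un⁻¹ * ((Ub * Uf * Ut⁻¹ * Un⁻¹)⁻¹ * (Wb * Wf * Wt⁻¹ * Wn⁻¹)) * Un
  set A' := (Wt' * Ut'⁻¹) * ((Ub' * Uf' * Ut'⁻¹ * Un'⁻¹ * Un')⁻¹ * (Ub' * Wb'⁻¹) * (Ub' * Uf' * Ut'⁻¹ * Un'⁻¹ * Un'))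
  set B' := Un'⁻¹ * ((Ub' * Uf' * Ut'⁻¹ * Un'⁻¹)⁻¹ * (Wb' * Wf' * Wt'⁻¹ * Wn'⁻¹)) * Un'
  -- the near rungs solved from the far rungs: `r_near = B⁻¹·A⁻¹·(W_top·r_far·W_top⁻¹)`
  set F := Wt * (Uf⁻¹ * Wf) * Wt⁻¹
  set F' := Wt' * (Uf'⁻¹ * Wf') * Wt'⁻¹
  have hn : Un⁻¹ * Wn = B⁻¹ * A⁻¹ * F := by simp only [A, B, F]; group
  have hn' : Un'⁻¹ * Wn' = B'⁻¹ * A'⁻¹ * F' := by simp only [A', B', F']; group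
  have key : Y * (Un'⁻¹ * Wn') * Y⁻¹ * (Un⁻¹ * Wn)⁻¹ =
      (Y * B'⁻¹ * Y⁻¹) * (Y * A'⁻¹ * Y⁻¹) * (Y * F' * Y⁻¹) * (B⁻¹ * A⁻¹ * F)⁻¹ := by
    rw [hn, hn']; group
  rw [key]
  have h1 := dist1_triple_telescope B⁻¹ A⁻¹ F (Y * B'⁻¹ * Y⁻¹) (Y * A'⁻¹ * Y⁻¹) (Y * F' * Y⁻¹)
  have hA : dist1 (Y * A'⁻¹ * Y⁻¹ * A⁻¹⁻¹) ≤ dist1 A' + dist1 A := by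
    have h := dist1_conj_mul_inv_le Y A⁻¹ A'⁻¹
    rwa [GaugeGroup.dist1_inv, GaugeGroup.dist1_inv] at h
  have hB : dist1 (Y * B'⁻¹ * Y⁻¹ * B⁻¹⁻¹) ≤ dist1 B' + dist1 B := by
    have h := dist1_conj_mul_inv_le Y B⁻¹ B'⁻¹
    rwa [GaugeGroup.dist1_inv, GaugeGroup.dist1_inv] at h
  have hBq : dist1 B = dist1 ((Ub * Uf * Ut⁻¹ * Un⁻¹)⁻¹ * (Wb * Wf * Wt⁻¹ * Wn⁻¹)) := by
    have h : B = Un⁻¹ * ((Ub * Uf * Ut⁻¹ * Un⁻¹)⁻¹ * (Wb * Wf * Wt⁻¹ * Wn⁻¹)) * Un⁻¹⁻¹ := by simp only [B, inv_inv]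
    rw [h, GaugeGroup.dist1_conj]
  have hBq' : dist1 B' = dist1 ((Ub' * Uf' * Ut'⁻¹ * Un'⁻¹)⁻¹ * (Wb' * Wf' * Wt'⁻¹ * Wn'⁻¹)) := by
    have h : B' = Un'⁻¹ * ((Ub' * Uf' * Ut'⁻¹ * Un'⁻¹)⁻¹ * (Wb' * Wf' * Wt'⁻¹ * Wn'⁻¹)) * Un'⁻¹⁻¹ := by simp only [B', inv_inv]
    rw [h, GaugeGroup.dist1_conj]
  -- the far pair with the induced transport, conjugated by `W_top`
  have hF : dist1 (Y * F' * Y⁻¹ * F⁻¹) = dist1 ((Wt⁻¹ * Y * Wt') * (Uf'⁻¹ * Wf') * (Wt⁻¹ * Y * Wt')⁻¹ * (Uf⁻¹ * Wf)⁻¹) := by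
    have h : (Wt⁻¹ * Y * Wt') * (Uf'⁻¹ * Wf') * (Wt⁻¹ * Y * Wt')⁻¹ * (Uf⁻¹ * Wf)⁻¹ = Wt⁻¹ * (Y * F' * Y⁻¹ * F⁻¹) * Wt⁻¹⁻¹ := by
      simp only [F, F']; group
    rw [h, GaugeGroup.dist1_conj]
  linarith [h1, hA, hB, hBq.le, hBq.ge, hBq'.le, hBq'.ge, hF.le, hF.ge]

end Summit.QuantumFields.YangMills.Theorems.FluctuationComparisonRegPrIntLS2BetaRelativeLadderVarTwoSquare
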